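import Summits.ABC.ABC.Theses.RibetTakahashiSplit
import Literature.NumberTheory.Automorphic.ShimuraCurve
import Literature.NumberTheory.EllipticCurves.Szpiro
import Literature.NumberTheory.DiophantineGeometry.ConductorRadicalProofs
import Literature.NumberTheory.DiophantineGeometry.PastenValuationProductsProofs
import Literature.NumberTheory.EllipticCurves.PastenValuationProduct

/-!
# Crux `FewPrimeValuationProduct` (stmt-ABC-1563) — reduction skeleton for the line `switching-triangle`
# (lead c1 RESHAPE, 2026-08-16: Literature vocabulary, no local definitions; lead c2, 2026-08-17:
# stub 5 `stub_depthResidual` carries the crux's H_card hypothesis `≤ 3` odd multiplicative primes — the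
# signature registered on the ledger 2026-08-16T14:08Z — and the composition threads H_card through)

Crux (route `ABC/RibetTakahashiSplit`, r4): for `E/ℚ` semistable away from `2` with `≤ 3` odd
multiplicative primes, `T(E) := ∏_{v ∥ N} c_v(E) ≤ C_ε N^ε`, `c_v := ord_v(Δ_min)`.

This is the planner's skeleton `Lines/switching_triangle.lean` (5 stubs, same composition) RE-TYPED by
the lead so that every stub is LANDABLE under `Theorems/` verbatim:
* the 13 local `def : Prop` / `structure ShimuraSetup` of the planner's file are gone — the
  arithmetic abbreviations (`multPrimes`, `cOrd`, `valProd`, `depth`, `IsSemistableAwayFromTwo`,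
  `IsFreyIsomorphic`) are UNFOLDED to the crux's own expressions, and the analytic objects are the
  Literature vocabulary `Literature.NumberTheory.Automorphic.ShimuraCurveData` (`X.Gamma = Γ₀^{pq}(M)`),
  `HasPeriodsIn`, `IsHypFundamentalDomain`, Mathlib `CuspForm _ 2`, `PeriodPair`, the tree's
  `IsGloballyMinimal` / `IsNeronLatticeOf` — the SAME dress as the sibling crux's line
  `ManyPrimeValuationProduct/Lines/jl_zero_cycle_height.lean` (stmt-ABC-1561), so results transfer;
* the lever is typed as the sibling's MINIMAL lever (`MeanSquareLowerBound`, mean-square form, no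
  Jensen) at the two-prime levels `(pq, N/(pq))` and WITHOUT the covering condition on `M`:
  `stub_twoPrimeMeanSquareLowerBound`;
* the package `stub_twoPrimePackage` keeps the planner's inequality
  `log(c_p c_q) ≤ C + ε log N + 2 log gcd(c_p,c_q) + log vol F − log ∫_F ‖s‖²_pt`
  (Pasten arXiv:1705.09251 (EqSequentially) p. 25 with `d = 1` + L.6.8 + L.6.14 + L.6.15, Frey's
  identity on both curves, Mazur–Kenku, Manin constant, `‖f‖² ≪ N log N`, Shimizu volume — every
  input now a named fact of `Literature.NumberTheory.Automorphic.ShimuraCurveRibetTakahashi` except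
  the pairwise gcd-bounded denominator of `γ_{pq,M,E}`, to be stated inline by the stub's prover).

Composition (all kernel-checked; `sorry` only in the five `stub_*`):
package + lever ⟹ `PairwiseGcdBound` (`pairwiseGcdBound_of`); three depth stubs ⟹ depth bound
(`depthBound_of`); simplex lemma (`simplex_bound`) ⟹ the crux (`crux_of_pairwise_depth`,
`FewPrimeValuationProduct_of` — the ONLY theorem concluding the route decl by name).

STATE OF THE STUBS (lead c2, 2026-08-17; everything below is ACCEPTED under
`Summits/ABC/ABC/Theorems/RibetTakahashiSplitFewPrimeValuationProduct*.lean`, namespace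
`Summit.ABC.ABC.Theorems.FewPrimeValuationProduct`, `--supports stmt-ABC-1563`):
* stub 1 `stub_twoPrimePackage` — closed MODULO its ten named facts: `stub_twoPrimePackage_of_facts`
  (…StubTwoPrimePackage.lean, p99190).
* stub 2 `stub_twoPrimeMeanSquareLowerBound` — OPEN (the lever; Conj. 1.14 strength). Its arithmetic
  shadow on the crux's class is crux-NECESSARY: `pairwiseGcdBound_hcard_of_fewPrimeValuationProduct`
  (…SwitchingPosition.lean).
* stub 3 `stub_depthSemistable` — closed MODULO `mestreOesterle1989_thm_1`:
  `stub_depthSemistable_of_mestreOesterle` (…StubDepthSemistable.lean, p100716).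
* stub 4 `stub_depthFrey` — closed MODULO FLT + `ribet1997_twoPowerFermat` + `darmonMerel1997_denesEquation`
  + `darmonGranville1995_thm_2`: `stub_depthFrey_of_namedFacts` (…StubDepthFrey.lean, p142570; no odd
  prime divides `G`, and `8 ∣ G` happens on a Darmon–Granville-finite set; `B = max 4 (2M)`).
* stub 5 `stub_depthResidual` — OPEN; reduced to the hasse-pinning depth half
  (`stub_depthResidual_of_hasse` = fixed-level congruence → least distinguishing prime → small-prime depth,
  …StubDepthResidual.lean, p142354) and crux-NECESSARY verbatim (`depthResidual_of_fewPrimeValuationProduct`).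
* glue — `pairwiseGcdBound_of_parts`, `fewPrimeValuationProduct_of_pairwise_depth` (…SwitchingGlue.lean,
  p143114); reach in one theorem: `fewPrimeValuationProduct_of_namedFacts_of_lever_of_depthResidual`
  (crux ⟸ 15 named facts + LEVER + DEPTH-RESIDUAL, …SwitchingPosition.lean).
-/

set_option linter.dupNamespace false

noncomputable section

open scoped MatrixGroups
open MeasureTheory

namespace Summit.ABC.ABC.Cruxes.FewPrimeValuationProduct.SwitchingTriangle

open Literature.NumberTheory.Automorphic
open Literature.NumberTheory.EllipticCurves.ModularForms (IsNeronLatticeOf)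
open Literature.NumberTheory.EllipticCurves (freyCurve)
open Summit.ABC.ABC.Theses.RibetTakahashiSplit (FewPrimeValuationProduct)

/-! ## The five stubs (statements fully unfolded; registered verbatim) -/

/-- **Stub 1 — the TWO-PRIME RIBET–TAKAHASHI–PASTEN PACKAGE** (KNOWN in print; L given the named
facts of `ShimuraCurveRibetTakahashi` + one inline printed fact). For every `ε > 0` there is `C` such
that for every elliptic `W/ℚ` semistable away from `2` and every pair of distinct multiplicative
primes `p, q` there exist a Néron period pair `L` (of a global minimal model), a Shimura curve datum
`X` of level `(pq, N/(pq))`, a fundamental domain `F` of `X.Gamma` of finite positive area and a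
non-zero weight-`2` form `s` on `X.Gamma` with periods in `Λ_L`, `‖s‖²_pt` integrable on `F` with
positive integral, such that
`log(c_p c_q) ≤ C + ε log N + 2 log gcd(c_p,c_q) + log vol(F) − log ∫_F ‖s‖²_pt dμ`.
In print: `c_p c_q = u⁻¹ (δ_{1,N}/δ_{pq,M}) i_p(1,N)² j_q(pq,M)²`, `H(u) ≤ 163²` (Prop 6.13 + L.6.8),
`i_p(1,N) ∣ κ_{{2}}` (L.6.14), `v_ℓ(j_q(pq,M)) ≤ min(v_ℓ c_p, v_ℓ c_q) + α(ℓ)` (L.6.15 twice, NO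
hypothesis on `M`); Frey's identity on `X₀(N)` (Zagier, tree) and on `X₀^{pq}(M)`
(`normSq_form_eq_deg_mul_covolume`), `minimalDegree_le_163_mul`, Manin `cor_10_2` with `S = {2}`,
`murty_petersson_newform_upper_bound`, `volume_fd_eq`; `s :=` the pulled-back Néron differential of
a minimal-degree Jacquet–Langlands parametrisation (`nonempty_shimuraParametrizationData`). -/
theorem stub_twoPrimePackage :
    ∀ ε : ℝ, 0 < ε → ∃ C : ℝ, ∀ (W : WeierstrassCurve ℚ) [W.IsElliptic],
      (∀ p : ℕ, p.Prime → p ≠ 2 → ¬ p ^ 2 ∣ W.conductorNorm ℤ) →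
      ∀ p ∈ (W.conductorNorm ℤ).primeFactors.filter (fun p => ¬ p ^ 2 ∣ W.conductorNorm ℤ),
      ∀ q ∈ (W.conductorNorm ℤ).primeFactors.filter (fun p => ¬ p ^ 2 ∣ W.conductorNorm ℤ), p ≠ q →
        ∃ (L : PeriodPair)
          (X : Literature.NumberTheory.Automorphic.ShimuraCurveData (p * q)
            (W.conductorNorm ℤ / (p * q)))
          (F : Set UpperHalfPlane) (s : CuspForm X.Gamma 2),
          (∃ C' : WeierstrassCurve.VariableChange ℚ, (C' • W).IsGloballyMinimal ∧
            Literature.NumberTheory.EllipticCurves.ModularForms.IsNeronLatticeOf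
              ((C' • W).baseChange ℂ) L) ∧
          Literature.NumberTheory.Automorphic.IsHypFundamentalDomain X.Gamma F ∧
          MeasureTheory.volume F ≠ 0 ∧ MeasureTheory.volume F ≠ ⊤ ∧ s ≠ 0 ∧
          Literature.NumberTheory.Automorphic.HasPeriodsIn X.Gamma s (L.lattice : Set ℂ) ∧
          MeasureTheory.IntegrableOn (fun z => ‖s z‖ ^ 2 * z.im ^ 2) F ∧
          (0 < ∫ z in F, ‖s z‖ ^ 2 * z.im ^ 2) ∧
          Real.log (((W.minimalDiscriminantNorm ℤ).factorization p *
              (W.minimalDiscriminantNorm ℤ).factorization q : ℕ) : ℝ) ≤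
            C + ε * Real.log (W.conductorNorm ℤ) +
              2 * Real.log (Nat.gcd ((W.minimalDiscriminantNorm ℤ).factorization p)
                ((W.minimalDiscriminantNorm ℤ).factorization q)) +
              Real.log (MeasureTheory.volume F).toReal -
                Real.log (∫ z in F, ‖s z‖ ^ 2 * z.im ^ 2) := by
  sorry

/-- **Stub 2 — TWO-PRIME MEAN-SQUARE LOWER BOUND = "Jacquet–Langlands preserves the size of integral
newforms" at the two-prime levels** (OPEN — THE LEVER, HARDEST; the lead holds it). For every `ε > 0`
there is `C` such that for every elliptic `W/ℚ` semistable away from `2`, distinct multiplicative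
primes `p, q`, Néron period pair `L`, EVERY Shimura curve datum `X` of level `(pq, N/(pq))`, every
fundamental domain `F` of finite positive area and every non-zero weight-`2` form `s` on `X.Gamma`
with periods in `Λ_L` and `0 < ∫_F ‖s‖²_pt < ∞`: the MEAN SQUARE is `≥ e^{−C} N^{−ε}`, i.e.
`−(ε log N + C) ≤ log((vol F)⁻¹ ∫_F ‖s‖²_pt)`. This is the sibling crux's minimal lever
`MeanSquareLowerBound` (line `jl_zero_cycle_height`, stmt-ABC-1561) with the covering set `D`
replaced by the pair `{p, q}` and NO covering condition on `N/(pq)` (Pasten L.6.15 is `M`-free) —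
route item stmt-ABC-1755 / Pasten's Conj. 1.14 at the levels Thm 6.1 (b) excludes. By Frey's
identity it says `deg Φ ≥ e^{2h(E)−C} N^{1−ε}` for every non-constant `Φ : X₀^{pq}(M)_ℂ → E_ℂ`.
Unconditionally true with `ε` replaced by `11/3 + ε` (Pasten Thm 14.1 + volume). -/
theorem stub_twoPrimeMeanSquareLowerBound :
    ∀ ε : ℝ, 0 < ε → ∃ C : ℝ, ∀ (W : WeierstrassCurve ℚ) [W.IsElliptic],
      (∀ p : ℕ, p.Prime → p ≠ 2 → ¬ p ^ 2 ∣ W.conductorNorm ℤ) →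
      ∀ p ∈ (W.conductorNorm ℤ).primeFactors.filter (fun p => ¬ p ^ 2 ∣ W.conductorNorm ℤ),
      ∀ q ∈ (W.conductorNorm ℤ).primeFactors.filter (fun p => ¬ p ^ 2 ∣ W.conductorNorm ℤ), p ≠ q →
      ∀ (L : PeriodPair), (∃ C' : WeierstrassCurve.VariableChange ℚ, (C' • W).IsGloballyMinimal ∧
          Literature.NumberTheory.EllipticCurves.ModularForms.IsNeronLatticeOf
            ((C' • W).baseChange ℂ) L) →
      ∀ (X : Literature.NumberTheory.Automorphic.ShimuraCurveData (p * q)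
          (W.conductorNorm ℤ / (p * q))) (F : Set UpperHalfPlane),
        Literature.NumberTheory.Automorphic.IsHypFundamentalDomain X.Gamma F →
        MeasureTheory.volume F ≠ 0 → MeasureTheory.volume F ≠ ⊤ →
      ∀ (s : CuspForm X.Gamma 2), s ≠ 0 →
        Literature.NumberTheory.Automorphic.HasPeriodsIn X.Gamma s (L.lattice : Set ℂ) →
        MeasureTheory.IntegrableOn (fun z => ‖s z‖ ^ 2 * z.im ^ 2) F →
        (0 < ∫ z in F, ‖s z‖ ^ 2 * z.im ^ 2) →
          -(ε * Real.log (W.conductorNorm ℤ) + C) ≤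
            Real.log ((MeasureTheory.volume F).toReal⁻¹ * ∫ z in F, ‖s z‖ ^ 2 * z.im ^ 2) := by
  sorry

/-- **Stub 3 — DEPTH OF SEMISTABLE CURVES** (KNOWN: Mestre–Oesterlé 1989 Thm 1, tree named fact
`Literature.NumberTheory.EllipticCurves.mestreOesterle1989_thm_1`; the deduction is
`depthSemistable_of_mestreOesterle` below, kernel-closed): for `N` squarefree with a bad prime,
`G(E) := gcd_{v ∣ N} c_v ≤ 5`. -/
theorem stub_depthSemistable :
    ∀ (W : WeierstrassCurve ℚ) [W.IsElliptic], Squarefree (W.conductorNorm ℤ) →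
      ((W.conductorNorm ℤ).primeFactors.filter (fun p => ¬ p ^ 2 ∣ W.conductorNorm ℤ)).Nonempty →
      ((W.conductorNorm ℤ).primeFactors.filter (fun p => ¬ p ^ 2 ∣ W.conductorNorm ℤ)).gcd
        (fun p => (W.minimalDiscriminantNorm ℤ).factorization p) ≤ 5 := by
  sorry

/-- **Stub 4 — DEPTH OF FREY–HELLEGOUARCH CURVES ADDITIVE AT 2** (KNOWN in print: Pasten L.6.12 +
L.6.9 = Wiles / Ribet 1997 / Darmon–Merel for odd primes `ℓ ≥ 5` dividing the depth — tree named
facts `FermatLastTheorem`, `ribet1997_twoPowerFermat`, `darmonMerel1997_denesEquation` — and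
Darmon–Granville finiteness for the exponents `8, 9, 5·?…` i.e. for the `2`- and `3`-parts): a
UNIFORM bound `G(E) ≤ B` for `E` semistable away from `2`, additive at `2` (`N` not squarefree),
`ℚ`-isomorphic to a twisted Frey curve `freyCurve (d a) (d b)` (`a, b` coprime, `ab(a+b) ≠ 0`,
`d ∣ 2`), with a multiplicative prime. (`G = 2 gcd_{v odd} v_v(ab(a+b))`; `G = 4` occurs:
`7² + 2³3² = 11²`.) -/
theorem stub_depthFrey :
    ∃ B : ℕ, ∀ (W : WeierstrassCurve ℚ) [W.IsElliptic],
      (∀ p : ℕ, p.Prime → p ≠ 2 → ¬ p ^ 2 ∣ W.conductorNorm ℤ) →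
      ¬ Squarefree (W.conductorNorm ℤ) →
      (∃ (a b d : ℤ) (C : WeierstrassCurve.VariableChange ℚ), IsCoprime a b ∧ a * b * (a + b) ≠ 0 ∧
        d ∣ 2 ∧ C • W = Literature.NumberTheory.EllipticCurves.freyCurve (d * a) (d * b)) →
      ((W.conductorNorm ℤ).primeFactors.filter (fun p => ¬ p ^ 2 ∣ W.conductorNorm ℤ)).Nonempty →
      ((W.conductorNorm ℤ).primeFactors.filter (fun p => ¬ p ^ 2 ∣ W.conductorNorm ℤ)).gcd
        (fun p => (W.minimalDiscriminantNorm ℤ).factorization p) ≤ B := by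
  sorry

/-- **Stub 5 — RESIDUAL (FIXED-LEVEL) DEPTH** (OPEN, foreign to the JL lever; = the depth half of the
sibling line `hasse-pinning-fixed-level` on the residual class): for `E` semistable away from `2`,
ADDITIVE at `2` and with NO twisted-Frey model, `G(E) ≤ C_ε N^ε`. Mechanism on record: `ℓ^m ∣ G` ⟹
`E[ℓ^m]` unramified at every odd bad prime ⟹ minimal `R = 𝕋` at level `∣ 2^10` pins `ρ_{E,ℓ^m}`
on one of finitely many fixed curves ⟹ Hasse pinning at the least distinguishing good prime (GRH:
`(log N)²`; unconditionally the Linnik wall); small `ℓ`: Pasten L.6.10. (H_card form, registered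
2026-08-16T14:08Z: the hasse-pinning depth half uses `≤ 3` odd multiplicative primes to exclude
irrational partners at five fixed odd primes.) -/
theorem stub_depthResidual :
    ∀ ε : ℝ, 0 < ε → ∃ C : ℝ, ∀ (W : WeierstrassCurve ℚ) [W.IsElliptic],
      (∀ p : ℕ, p.Prime → p ≠ 2 → ¬ p ^ 2 ∣ W.conductorNorm ℤ) →
      ((W.conductorNorm ℤ).primeFactors.filter
        (fun p => p ≠ 2 ∧ ¬ p ^ 2 ∣ W.conductorNorm ℤ)).card ≤ 3 →
      ¬ Squarefree (W.conductorNorm ℤ) →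
      (¬ ∃ (a b d : ℤ) (C : WeierstrassCurve.VariableChange ℚ), IsCoprime a b ∧ a * b * (a + b) ≠ 0 ∧
        d ∣ 2 ∧ C • W = Literature.NumberTheory.EllipticCurves.freyCurve (d * a) (d * b)) →
      ((W.conductorNorm ℤ).primeFactors.filter (fun p => ¬ p ^ 2 ∣ W.conductorNorm ℤ)).Nonempty →
      ((((W.conductorNorm ℤ).primeFactors.filter (fun p => ¬ p ^ 2 ∣ W.conductorNorm ℤ)).gcd
        (fun p => (W.minimalDiscriminantNorm ℤ).factorization p) : ℕ) : ℝ) ≤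
        C * (W.conductorNorm ℤ : ℝ) ^ ε := by
  sorry

/-! ## The pairwise gcd bound (the arithmetic shadow of package + lever) -/

/-- **PAIRWISE GCD BOUND** `c_p c_q ≤ C_ε N^ε gcd(c_p,c_q)²` for every pair of distinct multiplicative
primes of a curve semistable away from `2` (= `stub_pairSwitching` of the sibling line
`hasse-pinning-fixed-level`, verbatim up to the harmless positivity hypotheses there). -/
def PairwiseGcdBound : Prop :=
  ∀ ε : ℝ, 0 < ε → ∃ C : ℝ, ∀ (W : WeierstrassCurve ℚ) [W.IsElliptic],
    (∀ p : ℕ, p.Prime → p ≠ 2 → ¬ p ^ 2 ∣ W.conductorNorm ℤ) →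
    ∀ p ∈ (W.conductorNorm ℤ).primeFactors.filter (fun p => ¬ p ^ 2 ∣ W.conductorNorm ℤ),
    ∀ q ∈ (W.conductorNorm ℤ).primeFactors.filter (fun p => ¬ p ^ 2 ∣ W.conductorNorm ℤ), p ≠ q →
      (((W.minimalDiscriminantNorm ℤ).factorization p *
          (W.minimalDiscriminantNorm ℤ).factorization q : ℕ) : ℝ) ≤
        C * (W.conductorNorm ℤ : ℝ) ^ ε *
          ((Nat.gcd ((W.minimalDiscriminantNorm ℤ).factorization p)
            ((W.minimalDiscriminantNorm ℤ).factorization q) ^ 2 : ℕ) : ℝ)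

/-- `c_p c_q ≤ e^{A} · g²` from `log(c_p c_q) ≤ A + 2 log g` (with the degenerate cases `g = 0`,
`c_p c_q = 0`). -/
theorem natMul_le_of_log_le {m g : ℕ} {A : ℝ}
    (h : Real.log (m : ℝ) ≤ A + 2 * Real.log (g : ℝ)) (hmg : g = 0 → m = 0) :
    (m : ℝ) ≤ Real.exp A * ((g ^ 2 : ℕ) : ℝ) := by
  rcases Nat.eq_zero_or_pos g with hg | hg
  · have hm : m = 0 := hmg hg
    simp [hm, hg]
  rcases Nat.eq_zero_or_pos m with hm | hm
  · simp only [hm, Nat.cast_zero]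
    positivity
  have hm' : (0 : ℝ) < m := by exact_mod_cast hm
  have hg' : (0 : ℝ) < g := by exact_mod_cast hg
  calc (m : ℝ) = Real.exp (Real.log m) := (Real.exp_log hm').symm
    _ ≤ Real.exp (A + 2 * Real.log g) := Real.exp_le_exp.mpr h
    _ = Real.exp A * (g : ℝ) ^ 2 := by
        rw [Real.exp_add, show (2 : ℝ) * Real.log g = Real.log g + Real.log g by ring,
          Real.exp_add, Real.exp_log hg']
        ring
    _ = Real.exp A * ((g ^ 2 : ℕ) : ℝ) := by push_cast; ring

/-- **Package + lever ⟹ the pairwise gcd bound** (PROVED; stated with the two stub statements as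
hypotheses, verbatim, so that it lands as a support theorem):
`log(c_p c_q) ≤ C₁ + (ε/2) log N + 2 log g + log V − log I` and
`−((ε/2) log N + C₂) ≤ log(V⁻¹ I) = log I − log V` give `c_p c_q ≤ e^{C₁+C₂} N^ε g²`. -/
theorem pairwiseGcdBound_of
    (hPk : ∀ ε : ℝ, 0 < ε → ∃ C : ℝ, ∀ (W : WeierstrassCurve ℚ) [W.IsElliptic],
      (∀ p : ℕ, p.Prime → p ≠ 2 → ¬ p ^ 2 ∣ W.conductorNorm ℤ) →
      ∀ p ∈ (W.conductorNorm ℤ).primeFactors.filter (fun p => ¬ p ^ 2 ∣ W.conductorNorm ℤ),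
      ∀ q ∈ (W.conductorNorm ℤ).primeFactors.filter (fun p => ¬ p ^ 2 ∣ W.conductorNorm ℤ), p ≠ q →
        ∃ (L : PeriodPair)
          (X : Literature.NumberTheory.Automorphic.ShimuraCurveData (p * q)
            (W.conductorNorm ℤ / (p * q)))
          (F : Set UpperHalfPlane) (s : CuspForm X.Gamma 2),
          (∃ C' : WeierstrassCurve.VariableChange ℚ, (C' • W).IsGloballyMinimal ∧
            Literature.NumberTheory.EllipticCurves.ModularForms.IsNeronLatticeOf
              ((C' • W).baseChange ℂ) L) ∧
          Literature.NumberTheory.Automorphic.IsHypFundamentalDomain X.Gamma F ∧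
          MeasureTheory.volume F ≠ 0 ∧ MeasureTheory.volume F ≠ ⊤ ∧ s ≠ 0 ∧
          Literature.NumberTheory.Automorphic.HasPeriodsIn X.Gamma s (L.lattice : Set ℂ) ∧
          MeasureTheory.IntegrableOn (fun z => ‖s z‖ ^ 2 * z.im ^ 2) F ∧
          (0 < ∫ z in F, ‖s z‖ ^ 2 * z.im ^ 2) ∧
          Real.log (((W.minimalDiscriminantNorm ℤ).factorization p *
              (W.minimalDiscriminantNorm ℤ).factorization q : ℕ) : ℝ) ≤
            C + ε * Real.log (W.conductorNorm ℤ) +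
              2 * Real.log (Nat.gcd ((W.minimalDiscriminantNorm ℤ).factorization p)
                ((W.minimalDiscriminantNorm ℤ).factorization q)) +
              Real.log (MeasureTheory.volume F).toReal -
                Real.log (∫ z in F, ‖s z‖ ^ 2 * z.im ^ 2))
    (hL : ∀ ε : ℝ, 0 < ε → ∃ C : ℝ, ∀ (W : WeierstrassCurve ℚ) [W.IsElliptic],
      (∀ p : ℕ, p.Prime → p ≠ 2 → ¬ p ^ 2 ∣ W.conductorNorm ℤ) →
      ∀ p ∈ (W.conductorNorm ℤ).primeFactors.filter (fun p => ¬ p ^ 2 ∣ W.conductorNorm ℤ),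
      ∀ q ∈ (W.conductorNorm ℤ).primeFactors.filter (fun p => ¬ p ^ 2 ∣ W.conductorNorm ℤ), p ≠ q →
      ∀ (L : PeriodPair), (∃ C' : WeierstrassCurve.VariableChange ℚ, (C' • W).IsGloballyMinimal ∧
          Literature.NumberTheory.EllipticCurves.ModularForms.IsNeronLatticeOf
            ((C' • W).baseChange ℂ) L) →
      ∀ (X : Literature.NumberTheory.Automorphic.ShimuraCurveData (p * q)
          (W.conductorNorm ℤ / (p * q))) (F : Set UpperHalfPlane),
        Literature.NumberTheory.Automorphic.IsHypFundamentalDomain X.Gamma F →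
        MeasureTheory.volume F ≠ 0 → MeasureTheory.volume F ≠ ⊤ →
      ∀ (s : CuspForm X.Gamma 2), s ≠ 0 →
        Literature.NumberTheory.Automorphic.HasPeriodsIn X.Gamma s (L.lattice : Set ℂ) →
        MeasureTheory.IntegrableOn (fun z => ‖s z‖ ^ 2 * z.im ^ 2) F →
        (0 < ∫ z in F, ‖s z‖ ^ 2 * z.im ^ 2) →
          -(ε * Real.log (W.conductorNorm ℤ) + C) ≤
            Real.log ((MeasureTheory.volume F).toReal⁻¹ * ∫ z in F, ‖s z‖ ^ 2 * z.im ^ 2)) :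
    PairwiseGcdBound := by
  intro ε hε
  have hε2 : 0 < ε / 2 := half_pos hε
  obtain ⟨C₁, hC₁⟩ := hPk (ε / 2) hε2
  obtain ⟨C₂, hC₂⟩ := hL (ε / 2) hε2
  refine ⟨Real.exp (C₁ + C₂), fun W _ hss p hp q hq hpq => ?_⟩
  obtain ⟨L, X, F, s, hLn, hFD, hF0, hFt, hs0, hper, hint, hIpos, hineq⟩ := hC₁ W hss p hp q hq hpq
  have hlev := hC₂ W hss p hp q hq hpq L hLn X F hFD hF0 hFt s hs0 hper hint hIpos
  set N : ℝ := (W.conductorNorm ℤ : ℝ) with hNdef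
  set V : ℝ := (MeasureTheory.volume F).toReal with hVdef
  set I : ℝ := ∫ z in F, ‖s z‖ ^ 2 * z.im ^ 2 with hIdef
  set cp : ℕ := (W.minimalDiscriminantNorm ℤ).factorization p with hcp
  set cq : ℕ := (W.minimalDiscriminantNorm ℤ).factorization q with hcq
  have hN0' : 0 < W.conductorNorm ℤ := W.conductorNorm_pos_holds
  have hN : 0 < N := by rw [hNdef]; exact_mod_cast hN0'
  have hV : 0 < V := ENNReal.toReal_pos hF0 hFt
  have hlogVI : Real.log (V⁻¹ * I) = Real.log I - Real.log V := by
    rw [Real.log_mul (inv_ne_zero hV.ne') hIpos.ne', Real.log_inv]; ring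
  rw [hlogVI] at hlev
  -- log (c_p c_q) ≤ (C₁ + C₂ + ε log N) + 2 log g
  have hlog : Real.log ((cp * cq : ℕ) : ℝ) ≤
      (C₁ + C₂ + ε * Real.log N) + 2 * Real.log (Nat.gcd cp cq : ℝ) := by
    have : ε / 2 * Real.log N + ε / 2 * Real.log N = ε * Real.log N := by ring
    linarith
  have hdeg : Nat.gcd cp cq = 0 → cp * cq = 0 := fun h0 => by
    rw [(Nat.gcd_eq_zero_iff.mp h0).1, zero_mul]
  have h := natMul_le_of_log_le hlog hdeg
  calc ((cp * cq : ℕ) : ℝ)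
      ≤ Real.exp (C₁ + C₂ + ε * Real.log N) * ((Nat.gcd cp cq ^ 2 : ℕ) : ℝ) := h
    _ = Real.exp (C₁ + C₂) * N ^ ε * ((Nat.gcd cp cq ^ 2 : ℕ) : ℝ) := by
        rw [Real.exp_add, Real.rpow_def_of_pos hN, mul_comm (Real.log N) ε]

/-! ## The switching triangle / simplex lemma (PROVED, pure arithmetic) -/

section Simplex

/-- `gcd` and `lcm` of two divisors of `n > 0`: `d · e ≤ n · gcd(d, e)` (as `lcm(d,e) ∣ n`). -/
theorem mul_le_mul_gcd_of_dvd {n d e : ℕ} (hn : 0 < n) (hd : d ∣ n) (he : e ∣ n) :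
    d * e ≤ n * Nat.gcd d e := by
  have hl : Nat.lcm d e ≤ n := Nat.le_of_dvd hn (Nat.lcm_dvd hd he)
  calc d * e = Nat.gcd d e * Nat.lcm d e := (Nat.gcd_mul_lcm d e).symm
    _ ≤ Nat.gcd d e * n := Nat.mul_le_mul_left _ hl
    _ = n * Nat.gcd d e := Nat.mul_comm _ _

/-- **Divisors lemma**: if `d_b ∣ n` for all `b ∈ s` then
`n · ∏_{b ∈ s} d_b ≤ n^{#s} · gcd(n, gcd_b d_b)`. -/
theorem mul_prod_le_pow_mul_gcd {n : ℕ} (hn : 0 < n) (s : Finset ℕ) (d : ℕ → ℕ)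
    (hd : ∀ b ∈ s, d b ∣ n) :
    n * ∏ b ∈ s, d b ≤ n ^ s.card * Nat.gcd n (s.gcd d) := by
  classical
  induction s using Finset.induction_on with
  | empty => simp
  | @insert b s hb ih =>
    have hds : ∀ x ∈ s, d x ∣ n := fun x hx => hd x (Finset.mem_insert_of_mem hx)
    have hdb : d b ∣ n := hd b (Finset.mem_insert_self b s)
    have ih' := ih hds
    have he : Nat.gcd n (s.gcd d) ∣ n := Nat.gcd_dvd_left _ _
    rw [Finset.prod_insert hb, Finset.card_insert_of_notMem hb, Finset.gcd_insert]
    have hgcd : Nat.gcd n (GCDMonoid.gcd (d b) (s.gcd d)) = Nat.gcd (d b) (Nat.gcd n (s.gcd d)) := by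
      show Nat.gcd n (Nat.gcd (d b) (s.gcd d)) = Nat.gcd (d b) (Nat.gcd n (s.gcd d))
      rw [← Nat.gcd_assoc, Nat.gcd_comm n (d b), Nat.gcd_assoc]
    rw [hgcd]
    calc n * (d b * ∏ x ∈ s, d x) = d b * (n * ∏ x ∈ s, d x) := by ring
      _ ≤ d b * (n ^ s.card * Nat.gcd n (s.gcd d)) := Nat.mul_le_mul_left _ ih'
      _ = n ^ s.card * (d b * Nat.gcd n (s.gcd d)) := by ring
      _ ≤ n ^ s.card * (n * Nat.gcd (d b) (Nat.gcd n (s.gcd d))) :=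
          Nat.mul_le_mul_left _ (mul_le_mul_gcd_of_dvd hn hdb he)
      _ = n ^ (s.card + 1) * Nat.gcd (d b) (Nat.gcd n (s.gcd d)) := by ring

/-- `gcd(x, gcd_b gcd(x, f_b)) = gcd(x, gcd_b f_b)`. -/
theorem gcd_finsetGcd_gcd (x : ℕ) (s : Finset ℕ) (f : ℕ → ℕ) :
    Nat.gcd x (s.gcd (fun b => Nat.gcd x (f b))) = Nat.gcd x (s.gcd f) := by
  apply Nat.dvd_antisymm
  · refine Nat.dvd_gcd (Nat.gcd_dvd_left _ _) ?_
    refine Finset.dvd_gcd fun b hb => ?_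
    exact ((Nat.gcd_dvd_right _ _).trans (Finset.gcd_dvd hb)).trans (Nat.gcd_dvd_right _ _)
  · refine Nat.dvd_gcd (Nat.gcd_dvd_left _ _) ?_
    refine Finset.dvd_gcd fun b hb => ?_
    exact Nat.dvd_gcd (Nat.gcd_dvd_left _ _) ((Nat.gcd_dvd_right _ _).trans (Finset.gcd_dvd hb))

/-- **The simplex bound.** If `#S ≤ 4`, all `c_a ≥ 1` (`a ∈ S`) and `c_a c_b ≤ X · gcd(c_a,c_b)²`
for all `a ≠ b` in `S` (`X ≥ 1`), then `∏_{a ∈ S} c_a ≤ X^{12} · (gcd_{a ∈ S} c_a)^4`. -/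
theorem simplex_bound {S : Finset ℕ} {c : ℕ → ℕ} {X : ℕ} (hX : 1 ≤ X) (hS : S.Nonempty)
    (hk : S.card ≤ 4) (hc : ∀ a ∈ S, 1 ≤ c a)
    (h : ∀ a ∈ S, ∀ b ∈ S, a ≠ b → c a * c b ≤ X * Nat.gcd (c a) (c b) ^ 2) :
    ∏ a ∈ S, c a ≤ X ^ 12 * S.gcd c ^ 4 := by
  classical
  obtain ⟨a, ha, hmin⟩ := S.exists_min_image c hS
  set G := S.gcd c with hGdef
  set s := S.erase a with hsdef
  set j := s.card with hjdef
  have hj : j + 1 = S.card := Finset.card_erase_add_one ha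
  have hj3 : j ≤ 3 := by omega
  have hca : 1 ≤ c a := hc a ha
  have hca0 : 0 < c a := hca
  have hG : 1 ≤ G := by
    rcases Nat.eq_zero_or_pos G with h0 | h0
    · exact absurd ((Finset.gcd_eq_zero_iff.mp h0) a ha) (by omega)
    · exact h0
  have hA : ∀ b ∈ s, c b ≤ X * Nat.gcd (c a) (c b) := by
    intro b hb
    have hba : b ≠ a := (Finset.mem_erase.mp hb).1
    have hbS : b ∈ S := (Finset.mem_erase.mp hb).2
    have hab := h a ha b hbS hba.symm
    set g := Nat.gcd (c a) (c b) with hgdef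
    obtain ⟨m, hm⟩ : g ∣ c a := Nat.gcd_dvd_left _ _
    have hg0 : 0 < g := Nat.gcd_pos_of_pos_left _ hca0
    have hm1 : 1 ≤ m := by
      rcases Nat.eq_zero_or_pos m with h0 | h0
      · rw [h0, mul_zero] at hm; omega
      · exact h0
    have h1 : g * (m * c b) ≤ g * (X * g) := by
      calc g * (m * c b) = c a * c b := by rw [hm]; ring
        _ ≤ X * g ^ 2 := hab
        _ = g * (X * g) := by ring
    have h2 : m * c b ≤ X * g := Nat.le_of_mul_le_mul_left h1 hg0
    calc c b = 1 * c b := (one_mul _).symm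
      _ ≤ m * c b := Nat.mul_le_mul_right _ hm1
      _ ≤ X * g := h2
  have hprod : ∏ b ∈ S, c b = c a * ∏ b ∈ s, c b := (Finset.mul_prod_erase S c ha).symm
  have hB1 : ∏ b ∈ s, c b ≤ X ^ j * ∏ b ∈ s, Nat.gcd (c a) (c b) := by
    calc ∏ b ∈ s, c b ≤ ∏ b ∈ s, (X * Nat.gcd (c a) (c b)) :=
          Finset.prod_le_prod' fun b hb => hA b hb
      _ = X ^ j * ∏ b ∈ s, Nat.gcd (c a) (c b) := by
          rw [Finset.prod_mul_distrib, Finset.prod_const]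
  have hdiv : c a * ∏ b ∈ s, Nat.gcd (c a) (c b) ≤ c a ^ j * G := by
    have h1 := mul_prod_le_pow_mul_gcd hca0 s (fun b => Nat.gcd (c a) (c b))
      (fun b _ => Nat.gcd_dvd_left _ _)
    have h2 : Nat.gcd (c a) (s.gcd (fun b => Nat.gcd (c a) (c b))) = G := by
      rw [gcd_finsetGcd_gcd, hGdef, ← Finset.insert_erase ha, Finset.gcd_insert]
      rfl
    rw [h2] at h1
    exact h1
  have hT : ∏ b ∈ S, c b ≤ X ^ j * c a ^ j * G := by
    calc ∏ b ∈ S, c b = c a * ∏ b ∈ s, c b := hprod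
      _ ≤ c a * (X ^ j * ∏ b ∈ s, Nat.gcd (c a) (c b)) := Nat.mul_le_mul_left _ hB1
      _ = X ^ j * (c a * ∏ b ∈ s, Nat.gcd (c a) (c b)) := by ring
      _ ≤ X ^ j * (c a ^ j * G) := Nat.mul_le_mul_left _ hdiv
      _ = X ^ j * c a ^ j * G := by ring
  have hminT : c a ^ (j + 1) ≤ ∏ b ∈ S, c b := by
    rw [hj]; exact Finset.pow_card_le_prod S c (c a) fun b hb => hmin b hb
  have hcaXG : c a ≤ X ^ j * G := by
    have h1 : c a ^ j * c a ≤ c a ^ j * (X ^ j * G) := by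
      calc c a ^ j * c a = c a ^ (j + 1) := (pow_succ _ _).symm
        _ ≤ X ^ j * c a ^ j * G := hminT.trans hT
        _ = c a ^ j * (X ^ j * G) := by ring
    exact Nat.le_of_mul_le_mul_left h1 (pow_pos hca0 j)
  have hXj : X ^ j ≤ X ^ 3 := Nat.pow_le_pow_right hX hj3
  have hXG : 1 ≤ X ^ 3 * G := Nat.one_le_iff_ne_zero.mpr (by positivity)
  have hcaj : c a ^ j ≤ (X ^ 3 * G) ^ 3 :=
    calc c a ^ j ≤ (X ^ j * G) ^ j := Nat.pow_le_pow_left hcaXG j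
      _ ≤ (X ^ 3 * G) ^ j := Nat.pow_le_pow_left (Nat.mul_le_mul_right _ hXj) j
      _ ≤ (X ^ 3 * G) ^ 3 := Nat.pow_le_pow_right hXG hj3
  calc ∏ b ∈ S, c b ≤ X ^ j * c a ^ j * G := hT
    _ ≤ X ^ 3 * (X ^ 3 * G) ^ 3 * G := Nat.mul_le_mul (Nat.mul_le_mul hXj hcaj) le_rfl
    _ = X ^ 12 * G ^ 4 := by ring

end Simplex

/-! ## The crux from the pairwise bound and a depth bound (PROVED) -/

section Crux

variable (W : WeierstrassCurve ℚ)

/-- Every factor of `T(E)` is `≥ 1`: a prime of the conductor divides the minimal discriminant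
(`radical_conductorNorm_eq_holds`, PROVED in the tree). -/
theorem one_le_factorization_of_mem_filter [W.IsElliptic] {p : ℕ}
    (hp : p ∈ (W.conductorNorm ℤ).primeFactors.filter (fun p => ¬ p ^ 2 ∣ W.conductorNorm ℤ)) :
    1 ≤ (W.minimalDiscriminantNorm ℤ).factorization p := by
  have hrad : UniqueFactorizationMonoid.radical (W.conductorNorm ℤ) =
      UniqueFactorizationMonoid.radical (W.minimalDiscriminantNorm ℤ) :=
    W.radical_conductorNorm_eq_holds
  have hpf : (W.conductorNorm ℤ).primeFactors = (W.minimalDiscriminantNorm ℤ).primeFactors := by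
    rw [← Nat.primeFactors_radical, hrad, Nat.primeFactors_radical]
  have hp1 : p ∈ (W.conductorNorm ℤ).primeFactors := (Finset.mem_filter.mp hp).1
  rw [hpf] at hp1
  obtain ⟨hpp, hpd, hne⟩ := Nat.mem_primeFactors.mp hp1
  exact hpp.factorization_pos_of_dvd hne hpd

/-- At most four multiplicative primes in the few-prime class (`≤ 3` odd ones, and perhaps `2`). -/
theorem card_filter_le_four
    (hcard : ((W.conductorNorm ℤ).primeFactors.filter
      (fun p => p ≠ 2 ∧ ¬ p ^ 2 ∣ W.conductorNorm ℤ)).card ≤ 3) :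
    ((W.conductorNorm ℤ).primeFactors.filter (fun p => ¬ p ^ 2 ∣ W.conductorNorm ℤ)).card ≤ 4 := by
  classical
  set N := W.conductorNorm ℤ
  have hsub : N.primeFactors.filter (fun p => ¬ p ^ 2 ∣ N) ⊆
      insert 2 (N.primeFactors.filter (fun p => p ≠ 2 ∧ ¬ p ^ 2 ∣ N)) := by
    intro p hp
    rw [Finset.mem_insert, Finset.mem_filter]
    have hp' := Finset.mem_filter.mp hp
    by_cases h2 : p = 2
    · exact Or.inl h2
    · exact Or.inr ⟨hp'.1, h2, hp'.2⟩
  calc (N.primeFactors.filter (fun p => ¬ p ^ 2 ∣ N)).card ≤ _ := Finset.card_le_card hsub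
    _ ≤ (N.primeFactors.filter (fun p => p ≠ 2 ∧ ¬ p ^ 2 ∣ N)).card + 1 := Finset.card_insert_le _ _
    _ ≤ 4 := by omega

end Crux

/-- **The switching-triangle composition, relative to a sub-class `P`** (PROVED): the pairwise gcd
bound plus a depth bound `G(E) ≤ C_ε N^ε` on the curves satisfying `P` give `T(E) ≤ C_ε N^ε` for every
curve of the few-prime class satisfying `P`. With `X := ⌈K₁ N^{ε/16}⌉` and `G ≤ K₂ N^{ε/16}` the
simplex bound gives `T ≤ X^{12} G^4 ≤ (K₁+1)^{12} K₂^4 N^ε`. -/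
theorem valProd_le_of_bounds (P : WeierstrassCurve ℚ → Prop) (hP : PairwiseGcdBound)
    (hD : ∀ ε : ℝ, 0 < ε → ∃ C : ℝ, ∀ (W : WeierstrassCurve ℚ) [W.IsElliptic],
      (∀ p : ℕ, p.Prime → p ≠ 2 → ¬ p ^ 2 ∣ W.conductorNorm ℤ) →
      ((W.conductorNorm ℤ).primeFactors.filter
        (fun p => p ≠ 2 ∧ ¬ p ^ 2 ∣ W.conductorNorm ℤ)).card ≤ 3 → P W →
      ((W.conductorNorm ℤ).primeFactors.filter (fun p => ¬ p ^ 2 ∣ W.conductorNorm ℤ)).Nonempty →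
        ((((W.conductorNorm ℤ).primeFactors.filter (fun p => ¬ p ^ 2 ∣ W.conductorNorm ℤ)).gcd
          (fun p => (W.minimalDiscriminantNorm ℤ).factorization p) : ℕ) : ℝ) ≤
          C * (W.conductorNorm ℤ : ℝ) ^ ε) :
    ∀ ε : ℝ, 0 < ε → ∃ C : ℝ, ∀ (W : WeierstrassCurve ℚ) [W.IsElliptic],
      (∀ p : ℕ, p.Prime → p ≠ 2 → ¬ p ^ 2 ∣ W.conductorNorm ℤ) →
      ((W.conductorNorm ℤ).primeFactors.filter
        (fun p => p ≠ 2 ∧ ¬ p ^ 2 ∣ W.conductorNorm ℤ)).card ≤ 3 → P W →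
        ((∏ p ∈ (W.conductorNorm ℤ).primeFactors with ¬ p ^ 2 ∣ W.conductorNorm ℤ,
            (W.minimalDiscriminantNorm ℤ).factorization p : ℕ) : ℝ) ≤
          C * (W.conductorNorm ℤ : ℝ) ^ ε := by
  classical
  intro ε hε
  have hε' : 0 < ε / 16 := by positivity
  obtain ⟨C₁, hC₁⟩ := hP (ε / 16) hε'
  obtain ⟨C₂, hC₂⟩ := hD (ε / 16) hε'
  set K₁ : ℝ := max C₁ 0 + 1 with hK₁
  set K₂ : ℝ := max C₂ 1 with hK₂
  have hK₁1 : 1 ≤ K₁ := by have := le_max_right C₁ 0; linarith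
  have hK₁C : C₁ ≤ K₁ := by have := le_max_left C₁ 0; linarith
  have hK₂1 : 1 ≤ K₂ := le_max_right _ _
  refine ⟨(K₁ + 1) ^ 12 * K₂ ^ 4, fun W _ hss hcard hPW => ?_⟩
  set N : ℝ := (W.conductorNorm ℤ : ℝ) with hNdef
  set S : Finset ℕ := (W.conductorNorm ℤ).primeFactors.filter (fun p => ¬ p ^ 2 ∣ W.conductorNorm ℤ)
    with hSdef
  set c : ℕ → ℕ := fun p => (W.minimalDiscriminantNorm ℤ).factorization p with hcdef
  have hN0' : 0 < W.conductorNorm ℤ := W.conductorNorm_pos_holds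
  have hN1 : 1 ≤ N := by rw [hNdef]; exact_mod_cast hN0'
  have hN0 : 0 < N := by linarith
  have hNε' : 1 ≤ N ^ (ε / 16) := Real.one_le_rpow hN1 hε'.le
  have hNε : 1 ≤ N ^ ε := Real.one_le_rpow hN1 hε.le
  have hconst1 : 1 ≤ (K₁ + 1) ^ 12 * K₂ ^ 4 :=
    one_le_mul_of_one_le_of_one_le (one_le_pow₀ (by linarith)) (one_le_pow₀ hK₂1)
  have hTS : (∏ p ∈ (W.conductorNorm ℤ).primeFactors with ¬ p ^ 2 ∣ W.conductorNorm ℤ,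
      (W.minimalDiscriminantNorm ℤ).factorization p) = ∏ p ∈ S, c p := rfl
  rw [hTS]
  by_cases hS : S.Nonempty
  swap
  · have hempty : S = ∅ := Finset.not_nonempty_iff_eq_empty.mp hS
    rw [hempty, Finset.prod_empty, Nat.cast_one]
    exact one_le_mul_of_one_le_of_one_le hconst1 hNε
  set X : ℕ := ⌈K₁ * N ^ (ε / 16)⌉₊ with hXdef
  have hKN : 1 ≤ K₁ * N ^ (ε / 16) := one_le_mul_of_one_le_of_one_le hK₁1 hNε'
  have hX1 : 1 ≤ X := Nat.one_le_iff_ne_zero.mpr fun h0 => by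
    have := Nat.ceil_eq_zero.mp h0; linarith
  have hXle : (X : ℝ) ≤ (K₁ + 1) * N ^ (ε / 16) := by
    have h1 : (X : ℝ) < K₁ * N ^ (ε / 16) + 1 := Nat.ceil_lt_add_one (by linarith)
    nlinarith
  have hpair : ∀ a ∈ S, ∀ b ∈ S, a ≠ b → c a * c b ≤ X * Nat.gcd (c a) (c b) ^ 2 := by
    intro a ha b hb hab
    have h1 := hC₁ W hss a ha b hb hab
    have hg0 : (0 : ℝ) ≤ ((Nat.gcd (c a) (c b) ^ 2 : ℕ) : ℝ) := Nat.cast_nonneg _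
    have h2 : C₁ * N ^ (ε / 16) ≤ (X : ℝ) :=
      (mul_le_mul_of_nonneg_right hK₁C (by positivity)).trans (Nat.le_ceil _)
    have h3 : ((c a * c b : ℕ) : ℝ) ≤ (X : ℝ) * ((Nat.gcd (c a) (c b) ^ 2 : ℕ) : ℝ) :=
      h1.trans (mul_le_mul_of_nonneg_right h2 hg0)
    exact_mod_cast h3
  have hsimp := simplex_bound hX1 hS (card_filter_le_four W hcard)
    (fun a ha => one_le_factorization_of_mem_filter W ha) hpair
  have hG : ((S.gcd c : ℕ) : ℝ) ≤ K₂ * N ^ (ε / 16) :=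
    (hC₂ W hss hcard hPW hS).trans (mul_le_mul_of_nonneg_right (le_max_left _ _) (by positivity))
  have hG0 : (0 : ℝ) ≤ (S.gcd c : ℕ) := Nat.cast_nonneg _
  have hX0 : (0 : ℝ) ≤ X := Nat.cast_nonneg _
  have hpow : (N ^ (ε / 16)) ^ (16 : ℕ) = N ^ ε := by
    rw [← Real.rpow_natCast, ← Real.rpow_mul hN0.le]; norm_num
  calc ((∏ p ∈ S, c p : ℕ) : ℝ) ≤ ((X ^ 12 * S.gcd c ^ 4 : ℕ) : ℝ) := by exact_mod_cast hsimp
    _ = (X : ℝ) ^ 12 * ((S.gcd c : ℕ) : ℝ) ^ 4 := by push_cast; ring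
    _ ≤ ((K₁ + 1) * N ^ (ε / 16)) ^ 12 * (K₂ * N ^ (ε / 16)) ^ 4 := by
        gcongr
    _ = (K₁ + 1) ^ 12 * K₂ ^ 4 * (N ^ (ε / 16)) ^ (16 : ℕ) := by ring
    _ = (K₁ + 1) ^ 12 * K₂ ^ 4 * N ^ ε := by rw [hpow]

/-- **Three depth stubs ⟹ the depth bound on the whole class** (PROVED, excluded middle on
`Squarefree N` and on the twisted-Frey shape). -/
theorem depthBound_of
    (h₁ : ∀ (W : WeierstrassCurve ℚ) [W.IsElliptic], Squarefree (W.conductorNorm ℤ) →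
      ((W.conductorNorm ℤ).primeFactors.filter (fun p => ¬ p ^ 2 ∣ W.conductorNorm ℤ)).Nonempty →
      ((W.conductorNorm ℤ).primeFactors.filter (fun p => ¬ p ^ 2 ∣ W.conductorNorm ℤ)).gcd
        (fun p => (W.minimalDiscriminantNorm ℤ).factorization p) ≤ 5)
    (h₂ : ∃ B : ℕ, ∀ (W : WeierstrassCurve ℚ) [W.IsElliptic],
      (∀ p : ℕ, p.Prime → p ≠ 2 → ¬ p ^ 2 ∣ W.conductorNorm ℤ) →
      ¬ Squarefree (W.conductorNorm ℤ) →
      (∃ (a b d : ℤ) (C : WeierstrassCurve.VariableChange ℚ), IsCoprime a b ∧ a * b * (a + b) ≠ 0 ∧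
        d ∣ 2 ∧ C • W = Literature.NumberTheory.EllipticCurves.freyCurve (d * a) (d * b)) →
      ((W.conductorNorm ℤ).primeFactors.filter (fun p => ¬ p ^ 2 ∣ W.conductorNorm ℤ)).Nonempty →
      ((W.conductorNorm ℤ).primeFactors.filter (fun p => ¬ p ^ 2 ∣ W.conductorNorm ℤ)).gcd
        (fun p => (W.minimalDiscriminantNorm ℤ).factorization p) ≤ B)
    (h₃ : ∀ ε : ℝ, 0 < ε → ∃ C : ℝ, ∀ (W : WeierstrassCurve ℚ) [W.IsElliptic],
      (∀ p : ℕ, p.Prime → p ≠ 2 → ¬ p ^ 2 ∣ W.conductorNorm ℤ) →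
      ((W.conductorNorm ℤ).primeFactors.filter
        (fun p => p ≠ 2 ∧ ¬ p ^ 2 ∣ W.conductorNorm ℤ)).card ≤ 3 →
      ¬ Squarefree (W.conductorNorm ℤ) →
      (¬ ∃ (a b d : ℤ) (C : WeierstrassCurve.VariableChange ℚ), IsCoprime a b ∧ a * b * (a + b) ≠ 0 ∧
        d ∣ 2 ∧ C • W = Literature.NumberTheory.EllipticCurves.freyCurve (d * a) (d * b)) →
      ((W.conductorNorm ℤ).primeFactors.filter (fun p => ¬ p ^ 2 ∣ W.conductorNorm ℤ)).Nonempty →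
      ((((W.conductorNorm ℤ).primeFactors.filter (fun p => ¬ p ^ 2 ∣ W.conductorNorm ℤ)).gcd
        (fun p => (W.minimalDiscriminantNorm ℤ).factorization p) : ℕ) : ℝ) ≤
        C * (W.conductorNorm ℤ : ℝ) ^ ε) :
    ∀ ε : ℝ, 0 < ε → ∃ C : ℝ, ∀ (W : WeierstrassCurve ℚ) [W.IsElliptic],
      (∀ p : ℕ, p.Prime → p ≠ 2 → ¬ p ^ 2 ∣ W.conductorNorm ℤ) →
      ((W.conductorNorm ℤ).primeFactors.filter
        (fun p => p ≠ 2 ∧ ¬ p ^ 2 ∣ W.conductorNorm ℤ)).card ≤ 3 → True →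
      ((W.conductorNorm ℤ).primeFactors.filter (fun p => ¬ p ^ 2 ∣ W.conductorNorm ℤ)).Nonempty →
        ((((W.conductorNorm ℤ).primeFactors.filter (fun p => ¬ p ^ 2 ∣ W.conductorNorm ℤ)).gcd
          (fun p => (W.minimalDiscriminantNorm ℤ).factorization p) : ℕ) : ℝ) ≤
          C * (W.conductorNorm ℤ : ℝ) ^ ε := by
  obtain ⟨B, hB⟩ := h₂
  intro ε hε
  obtain ⟨C₃, hC₃⟩ := h₃ ε hε
  refine ⟨5 + B + max C₃ 0, fun W _ hss hcard _ hS => ?_⟩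
  set N : ℝ := (W.conductorNorm ℤ : ℝ) with hNdef
  set G : ℕ := ((W.conductorNorm ℤ).primeFactors.filter (fun p => ¬ p ^ 2 ∣ W.conductorNorm ℤ)).gcd
    (fun p => (W.minimalDiscriminantNorm ℤ).factorization p) with hGdef
  have hN0' : 0 < W.conductorNorm ℤ := W.conductorNorm_pos_holds
  have hN1 : 1 ≤ N := by rw [hNdef]; exact_mod_cast hN0'
  have hNε : 1 ≤ N ^ ε := Real.one_le_rpow hN1 hε.le
  have hC0 : 0 ≤ max C₃ 0 := le_max_right _ _
  have hB0 : (0 : ℝ) ≤ B := Nat.cast_nonneg _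
  by_cases hsq : Squarefree (W.conductorNorm ℤ)
  · have h := h₁ W hsq hS
    have h' : (G : ℝ) ≤ 5 := by exact_mod_cast h
    nlinarith
  by_cases hF : ∃ (a b d : ℤ) (C : WeierstrassCurve.VariableChange ℚ), IsCoprime a b ∧
      a * b * (a + b) ≠ 0 ∧ d ∣ 2 ∧ C • W = freyCurve (d * a) (d * b)
  · have h := hB W hss hsq hF hS
    have h' : (G : ℝ) ≤ B := by exact_mod_cast h
    nlinarith
  · have h := hC₃ W hss hcard hsq hF hS
    have h' : C₃ * N ^ ε ≤ max C₃ 0 * N ^ ε :=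
      mul_le_mul_of_nonneg_right (le_max_left _ _) (by positivity)
    nlinarith

/-- **`PairwiseGcdBound` + depth bound on the class ⟹ the crux** (the switching triangle on the
whole class, PROVED; conclusion = the crux UNFOLDED — only `FewPrimeValuationProduct_of` below
concludes the route decl by name). -/
theorem crux_of_pairwise_depth (hP : PairwiseGcdBound)
    (hD : ∀ ε : ℝ, 0 < ε → ∃ C : ℝ, ∀ (W : WeierstrassCurve ℚ) [W.IsElliptic],
      (∀ p : ℕ, p.Prime → p ≠ 2 → ¬ p ^ 2 ∣ W.conductorNorm ℤ) →
      ((W.conductorNorm ℤ).primeFactors.filter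
        (fun p => p ≠ 2 ∧ ¬ p ^ 2 ∣ W.conductorNorm ℤ)).card ≤ 3 → True →
      ((W.conductorNorm ℤ).primeFactors.filter (fun p => ¬ p ^ 2 ∣ W.conductorNorm ℤ)).Nonempty →
        ((((W.conductorNorm ℤ).primeFactors.filter (fun p => ¬ p ^ 2 ∣ W.conductorNorm ℤ)).gcd
          (fun p => (W.minimalDiscriminantNorm ℤ).factorization p) : ℕ) : ℝ) ≤
          C * (W.conductorNorm ℤ : ℝ) ^ ε) :
    ∀ ε : ℝ, 0 < ε → ∃ C : ℝ, ∀ (W : WeierstrassCurve ℚ) [W.IsElliptic],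
      (∀ p : ℕ, p.Prime → p ≠ 2 → ¬ p ^ 2 ∣ W.conductorNorm ℤ) →
      ((W.conductorNorm ℤ).primeFactors.filter
        (fun p => p ≠ 2 ∧ ¬ p ^ 2 ∣ W.conductorNorm ℤ)).card ≤ 3 →
        ((∏ p ∈ (W.conductorNorm ℤ).primeFactors with ¬ p ^ 2 ∣ W.conductorNorm ℤ,
            (W.minimalDiscriminantNorm ℤ).factorization p : ℕ) : ℝ) ≤
          C * (W.conductorNorm ℤ : ℝ) ^ ε := by
  have h := valProd_le_of_bounds (fun _ => True) hP hD
  intro ε hε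
  obtain ⟨C, hC⟩ := h ε hε
  exact ⟨C, fun W _ hss hcard => hC W hss hcard trivial⟩

/-! ## The crux from the line -/

/-- **The crux from the line** — the ONLY theorem of this file concluding
`Summit.ABC.ABC.Theses.RibetTakahashiSplit.FewPrimeValuationProduct`, BY NAME; no hypotheses, the
five registered stubs are INVOKED (sorries live only in `stub_*`; everything else is kernel-closed).
Chain: package + lever ⟹ `PairwiseGcdBound` (`pairwiseGcdBound_of`); semistable + Frey + residual
depth ⟹ depth bound (`depthBound_of`); simplex lemma ⟹ the crux (`crux_of_pairwise_depth`). -/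
theorem FewPrimeValuationProduct_of : FewPrimeValuationProduct :=
  crux_of_pairwise_depth
    (pairwiseGcdBound_of stub_twoPrimePackage stub_twoPrimeMeanSquareLowerBound)
    (depthBound_of stub_depthSemistable stub_depthFrey stub_depthResidual)

/-! ## Stub 3 modulo the named fact (PROVED): Mestre–Oesterlé ⟹ `stub_depthSemistable` -/

/-- **`mestreOesterle1989_thm_1 →` the statement of `stub_depthSemistable`** (PROVED): for `N`
squarefree the multiplicative primes are `primeFactors N = primeFactors Δ_min`
(`radical_conductorNorm_eq_holds`), `G ∣ c_p` for every `p ∣ Δ_min`, hence `Δ_min = (∏ p^{c_p/G})^G`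
with base `≥ 2`, and `W.IsSemistable ℤ` (`isSemistable_iff_squarefree_conductorNorm`); Théorème 1
gives `G ≤ 5`. -/
theorem depthSemistable_of_mestreOesterle
    (hMO : Literature.NumberTheory.EllipticCurves.mestreOesterle1989_thm_1) :
    ∀ (W : WeierstrassCurve ℚ) [W.IsElliptic], Squarefree (W.conductorNorm ℤ) →
      ((W.conductorNorm ℤ).primeFactors.filter (fun p => ¬ p ^ 2 ∣ W.conductorNorm ℤ)).Nonempty →
      ((W.conductorNorm ℤ).primeFactors.filter (fun p => ¬ p ^ 2 ∣ W.conductorNorm ℤ)).gcd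
        (fun p => (W.minimalDiscriminantNorm ℤ).factorization p) ≤ 5 := by
  classical
  intro W _ hsq hS
  set N := W.conductorNorm ℤ with hN
  set Δ := W.minimalDiscriminantNorm ℤ with hΔ
  set MP : Finset ℕ := N.primeFactors.filter (fun p => ¬ p ^ 2 ∣ N) with hMPdef
  have hmult : MP = N.primeFactors := by
    apply Finset.filter_true_of_mem
    intro p hp h2
    have hp' : p.Prime := Nat.prime_of_mem_primeFactors hp
    exact (Nat.squarefree_iff_prime_squarefree.mp hsq) p hp' (by simpa [sq] using h2)
  have hrad : UniqueFactorizationMonoid.radical N = UniqueFactorizationMonoid.radical Δ :=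
    W.radical_conductorNorm_eq_holds
  have hpf : N.primeFactors = Δ.primeFactors := by
    rw [← Nat.primeFactors_radical, hrad, Nat.primeFactors_radical]
  set G : ℕ := MP.gcd (fun p => Δ.factorization p) with hGdef
  have hGdvd : ∀ p ∈ Δ.primeFactors, G ∣ Δ.factorization p := by
    intro p hp
    have hp' : p ∈ MP := by rw [hmult, hpf]; exact hp
    exact Finset.gcd_dvd hp'
  obtain ⟨a, ha⟩ := hS
  have hca : 1 ≤ Δ.factorization a := one_le_factorization_of_mem_filter W ha
  have haΔ : a ∈ Δ.primeFactors := by rw [← hpf, ← hmult]; exact ha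
  have hG1 : 1 ≤ G := by
    rcases Nat.eq_zero_or_pos G with h0 | h0
    · have h0' : Δ.factorization a = 0 := (Finset.gcd_eq_zero_iff.mp h0) a ha
      omega
    · exact h0
  have hΔ0 : Δ ≠ 0 := by
    intro h0
    rw [h0, Nat.primeFactors_zero] at haΔ
    simp at haΔ
  set k := ∏ p ∈ Δ.primeFactors, p ^ (Δ.factorization p / G) with hk
  have hΔk : Δ = k ^ G := by
    conv_lhs => rw [← Nat.prod_factorization_pow_eq_self hΔ0]
    rw [Nat.prod_factorization_eq_prod_primeFactors, hk, ← Finset.prod_pow]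
    refine Finset.prod_congr rfl fun p hp => ?_
    rw [← pow_mul, Nat.div_mul_cancel (hGdvd p hp)]
  have hk2 : 2 ≤ k := by
    have hterm : ∀ p ∈ Δ.primeFactors, 1 ≤ p ^ (Δ.factorization p / G) := fun p hp =>
      Nat.one_le_pow _ _ (Nat.prime_of_mem_primeFactors hp).pos
    have hdiv : 1 ≤ Δ.factorization a / G :=
      (Nat.one_le_div_iff hG1).mpr (Nat.le_of_dvd hca (hGdvd a haΔ))
    calc 2 ≤ a := (Nat.prime_of_mem_primeFactors haΔ).two_le
      _ ≤ a ^ (Δ.factorization a / G) := Nat.le_self_pow (by omega) a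
      _ ≤ k := Finset.single_le_prod' hterm haΔ
  have hss : W.IsSemistable ℤ := (W.isSemistable_iff_squarefree_conductorNorm).mpr hsq
  exact hMO W hss G k hk2 hΔk

/-- **Reach of the line without the open depth residual** (PROVED reduction): for every curve of
the few-prime class that is semistable or twisted-Frey — in particular every curve the route's
Assembly feeds into the crux — `T(E) ≤ C_ε N^ε` follows from `PairwiseGcdBound` (package + lever)
and the two KNOWN depth stubs alone. -/
theorem valProd_le_of_semistable_or_frey (hP : PairwiseGcdBound)
    (h₁ : ∀ (W : WeierstrassCurve ℚ) [W.IsElliptic], Squarefree (W.conductorNorm ℤ) →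
      ((W.conductorNorm ℤ).primeFactors.filter (fun p => ¬ p ^ 2 ∣ W.conductorNorm ℤ)).Nonempty →
      ((W.conductorNorm ℤ).primeFactors.filter (fun p => ¬ p ^ 2 ∣ W.conductorNorm ℤ)).gcd
        (fun p => (W.minimalDiscriminantNorm ℤ).factorization p) ≤ 5)
    (h₂ : ∃ B : ℕ, ∀ (W : WeierstrassCurve ℚ) [W.IsElliptic],
      (∀ p : ℕ, p.Prime → p ≠ 2 → ¬ p ^ 2 ∣ W.conductorNorm ℤ) →
      ¬ Squarefree (W.conductorNorm ℤ) →
      (∃ (a b d : ℤ) (C : WeierstrassCurve.VariableChange ℚ), IsCoprime a b ∧ a * b * (a + b) ≠ 0 ∧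
        d ∣ 2 ∧ C • W = Literature.NumberTheory.EllipticCurves.freyCurve (d * a) (d * b)) →
      ((W.conductorNorm ℤ).primeFactors.filter (fun p => ¬ p ^ 2 ∣ W.conductorNorm ℤ)).Nonempty →
      ((W.conductorNorm ℤ).primeFactors.filter (fun p => ¬ p ^ 2 ∣ W.conductorNorm ℤ)).gcd
        (fun p => (W.minimalDiscriminantNorm ℤ).factorization p) ≤ B) :
    ∀ ε : ℝ, 0 < ε → ∃ C : ℝ, ∀ (W : WeierstrassCurve ℚ) [W.IsElliptic],
      (∀ p : ℕ, p.Prime → p ≠ 2 → ¬ p ^ 2 ∣ W.conductorNorm ℤ) →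
      ((W.conductorNorm ℤ).primeFactors.filter
        (fun p => p ≠ 2 ∧ ¬ p ^ 2 ∣ W.conductorNorm ℤ)).card ≤ 3 →
      (Squarefree (W.conductorNorm ℤ) ∨
        ∃ (a b d : ℤ) (C : WeierstrassCurve.VariableChange ℚ), IsCoprime a b ∧ a * b * (a + b) ≠ 0 ∧
          d ∣ 2 ∧ C • W = Literature.NumberTheory.EllipticCurves.freyCurve (d * a) (d * b)) →
        ((∏ p ∈ (W.conductorNorm ℤ).primeFactors with ¬ p ^ 2 ∣ W.conductorNorm ℤ,
            (W.minimalDiscriminantNorm ℤ).factorization p : ℕ) : ℝ) ≤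
          C * (W.conductorNorm ℤ : ℝ) ^ ε := by
  obtain ⟨B, hB⟩ := h₂
  refine valProd_le_of_bounds (fun W => Squarefree (W.conductorNorm ℤ) ∨
      ∃ (a b d : ℤ) (C : WeierstrassCurve.VariableChange ℚ), IsCoprime a b ∧ a * b * (a + b) ≠ 0 ∧
        d ∣ 2 ∧ C • W = freyCurve (d * a) (d * b)) hP
    (fun ε hε => ⟨5 + B, fun W _ hss _ hor hS => ?_⟩)
  set G : ℕ := ((W.conductorNorm ℤ).primeFactors.filter (fun p => ¬ p ^ 2 ∣ W.conductorNorm ℤ)).gcd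
    (fun p => (W.minimalDiscriminantNorm ℤ).factorization p) with hGdef
  have hN1 : (1 : ℝ) ≤ (W.conductorNorm ℤ : ℝ) := by exact_mod_cast W.conductorNorm_pos_holds
  have hNε : 1 ≤ (W.conductorNorm ℤ : ℝ) ^ ε := Real.one_le_rpow hN1 hε.le
  have hB0 : (0 : ℝ) ≤ B := Nat.cast_nonneg _
  have hd : (G : ℝ) ≤ 5 + B := by
    by_cases hsq : Squarefree (W.conductorNorm ℤ)
    · have h' : (G : ℝ) ≤ 5 := by exact_mod_cast h₁ W hsq hS
      linarith
    · have h' : (G : ℝ) ≤ B := by exact_mod_cast hB W hss hsq (hor.resolve_left hsq) hS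
      linarith
  nlinarith

end Summit.ABC.ABC.Cruxes.FewPrimeValuationProduct.SwitchingTriangle

end
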